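import Literature.Computability.AlgebraicComplexity.KoiranCriterionWitness
import HarnessLib

/-!
# Discharge of `Burgisser2009_thm41_koiranStep` (Koiran's generalized Valiant criterion, constant-free)

With the witness `gK` of `KoiranCriterionWitness.lean` and the `(size, formal degree)` calculus
(`ConstantFreeDegree.lean`, `CircuitArithmetizationTau.lean`, `BooleanGadgetsTau.lean`) we prove
the named fact `Burgisser2009_thm41_koiranStep` of `BurgisserTransfer.lean` — the application of
Bürgisser 2009, Thm. 2.11 (= Koiran 2004, Thm. 6.1) displayed in the proof of Thm. 4.1(2)
(ECCC TR06-113, p. 14–15; STACS 2007 Thm. 10): for `p, q` polynomially bounded with `p n ≥ n` and a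
0/1 array `b(n, k, j)` decided in `P/poly` on its index domain, the two-block polynomials
`B_n = twoBlockPoly p q b n` are the substitution instances `blockSubst p q n` of ONE family
`(G_{ℓ,μ}) ∈ VNP⁰` at `ℓ = bitLen (p n)`, `μ = bitLen (q n)`.

* `HasTauDeg.totalDegree_le`, `IsVP0Family.of_hasTauDeg` — the bridges from the calculus to
  Bürgisser's Def. 2.7;
* `KoiranW.hasTauDeg_gK` — `gK` has a constant-free circuit of size and formal degree polynomial
  in `ℓ + μ + M`;
* `KoiranW.KData`, `KData.G` — the family from the circuit data of the `P/poly` language;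
  `KData.isVNP0Family_G` (`VNP⁰` membership, index `r ↦ (ℓ, μ) = Nat.unpair r`) and
  `KData.aeval_blockSubst_G` (the substitution identity);
* `Burgisser2009_thm41_koiranStep_holds` — the discharge (D-0014).

## References

* P. Bürgisser, *On defining integers and proving arithmetic circuit lower bounds*, Comput.
  Complexity 18 (2009) = ECCC TR06-113, Def. 2.7, Def. 2.8, Thm. 2.11, proof of Thm. 4.1(2);
  STACS 2007, LNCS 4393, Thm. 10.
* P. Koiran, *Valiant's model and the cost of computing integers*, Comput. Complexity 13 (2004),
  Thm. 6.1.
-/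

noncomputable section

open MvPolynomial

universe u v w

namespace Literature.Computability.AlgebraicComplexity

open Complexity CircuitArith BoolGadgets _root_.Computability ArithCircuit

/-! ### Bridges: from `HasTauDeg` to `VP⁰` -/

/-- The total degree is at most the formal degree bound. [cite: Burgisser2006, §2.2] -/
theorem HasTauDeg.totalDegree_le {σ : Type v} {f : MvPolynomial σ ℤ} {s d : ℕ} (h : HasTauDeg f s d) :
    f.totalDegree ≤ d := by
  obtain ⟨P, -, -, h3, -, h5⟩ := h
  have := ArithCircuit.totalDegree_eval_le_formalDegree P
  rw [h3] at this
  exact this.trans h5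

/-- **`VP⁰` membership from the calculus**: a family with `HasTauDeg (f n) (s n) (d n)`, `s, d`
and the number of variables polynomially bounded, is in `VP⁰` (Bürgisser 2009, Def. 2.7). [cite: Burgisser2006, Def. 2.7] -/
theorem IsVP0Family.of_hasTauDeg {σ : ℕ → Type v} [∀ n, Fintype (σ n)] {f : ∀ n, MvPolynomial (σ n) ℤ}
    (hσ : IsPBounded fun n => Fintype.card (σ n)) {s d : ℕ → ℕ} (hs : IsPBounded s) (hd : IsPBounded d)
    (h : ∀ n, HasTauDeg (f n) (s n) (d n)) : IsVP0Family f := by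
  choose P h1 h2 h3 h4 h5 using h
  exact ⟨hσ, P, fun n => ⟨h1 n, h2 n, h3 n⟩, hs.mono fun n => h4 n, hd.mono fun n => h5 n⟩

namespace KoiranW

variable (π : KParams)

/-! ### `(size, formal degree)` of the witness -/

/-- Size bound of a term. [folklore] -/
def termSize : ℕ := 8 * (π.ℓ + π.μ) * (π.ℓ + π.μ) + 18 * (π.ℓ + π.μ) + 60 * π.M + 11

/-- Formal degree bound of a term. [folklore] -/
def termDeg : ℕ := 4 * (π.ℓ + π.μ) + 3 * π.M + 12

/-- `ACC a c d` in range: `(60 M + 1, 3 M + 2)`. [cite: Burgisser2006, §2.2] -/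
theorem hasTauDeg_ACC {a c d : ℕ} (ha : a ≤ π.ℓ + π.μ) (hc : c ≤ π.μ) (hd : d ≤ π.ℓ) :
    HasTauDeg (ACC π a c d) (60 * π.M + 1) (3 * π.M + 2) := by
  unfold ACC
  rw [← aeval_eq_bind₁]
  have h := hasTauDeg_aeval_arith (Qw π a c d) (g := σw π a c d) (hasTauDeg_σw π a c d)
  have hs := size_Qw π ha hc hd
  exact h.mono (by omega) (by omega)

/-- **`TERM a c d` in range: `(termSize, termDeg)`.** [cite: Burgisser2006, §2.2] -/
theorem hasTauDeg_TERM {a c d : ℕ} (ha : a ≤ π.ℓ + π.μ) (hc : c ≤ π.μ) (hd : d ≤ π.ℓ) :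
    HasTauDeg (TERM π a c d) (termSize π) (termDeg π) := by
  unfold TERM
  have hN : ∀ t, HasTauDeg (Nv π t) 0 1 := fun t => HasTauDeg.X _
  have hP : ∀ t, HasTauDeg (Pv π t) 0 1 := fun t => HasTauDeg.X _
  have hQ : ∀ t, HasTauDeg (Qv π t) 0 1 := fun t => HasTauDeg.X _
  have hJ : ∀ t, HasTauDeg (Jv π t) 0 1 := fun t => HasTauDeg.X _
  have hK : ∀ t, HasTauDeg (Kv π t) 0 1 := fun t => HasTauDeg.X _
  have h := (((((hasTauDeg_lenInd hN a).mul (hasTauDeg_lenInd hK c)).mul (hasTauDeg_lenInd hJ d)).mul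
    (hasTauDeg_leInd π.ℓ hJ hP)).mul (hasTauDeg_leInd π.μ hK hQ)).mul (hasTauDeg_ACC π ha hc hd)
  refine h.mono ?_ ?_
  · unfold termSize; nlinarith [Nat.zero_le π.ℓ, Nat.zero_le π.μ]
  · unfold termDeg; omega

/-- Size bound of the scalar gadget. [folklore] -/
def termSumSize : ℕ :=
  (π.ℓ + π.μ + 1) * ((π.μ + 1) * ((π.ℓ + 1) * termSize π + (π.ℓ + 1)) + (π.μ + 1)) + (π.ℓ + π.μ + 1)

/-- **`TERMSUM`: `(termSumSize, termDeg)`.** [cite: Burgisser2006, §2.2] -/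
theorem hasTauDeg_TERMSUM : HasTauDeg (TERMSUM π) (termSumSize π) (termDeg π) := by
  unfold TERMSUM termSumSize
  have hdeg : max 1 (termDeg π) = termDeg π := max_eq_right (by unfold termDeg; omega)
  have h3 : ∀ a ∈ Finset.range (π.ℓ + π.μ + 1), ∀ c ∈ Finset.range (π.μ + 1),
      HasTauDeg (∑ d ∈ Finset.range (π.ℓ + 1), TERM π a c d) ((π.ℓ + 1) * termSize π + (π.ℓ + 1)) (termDeg π) := by
    intro a ha c hc
    have h := HasTauDeg.finset_sum (Finset.range (π.ℓ + 1)) (s := fun _ => termSize π) (d := termDeg π)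
      fun d hd => hasTauDeg_TERM π (by simpa [Nat.lt_succ_iff] using ha) (by simpa [Nat.lt_succ_iff] using hc)
        (by simpa [Nat.lt_succ_iff] using hd)
    simp only [Finset.sum_const, Finset.card_range, smul_eq_mul, hdeg] at h
    exact h
  have h2 : ∀ a ∈ Finset.range (π.ℓ + π.μ + 1),
      HasTauDeg (∑ c ∈ Finset.range (π.μ + 1), ∑ d ∈ Finset.range (π.ℓ + 1), TERM π a c d)
        ((π.μ + 1) * ((π.ℓ + 1) * termSize π + (π.ℓ + 1)) + (π.μ + 1)) (termDeg π) := by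
    intro a ha
    have h := HasTauDeg.finset_sum (Finset.range (π.μ + 1)) (s := fun _ => (π.ℓ + 1) * termSize π + (π.ℓ + 1))
      (d := termDeg π) fun c hc => h3 a ha c hc
    simp only [Finset.sum_const, Finset.card_range, smul_eq_mul, hdeg] at h
    exact h
  have h := HasTauDeg.finset_sum (Finset.range (π.ℓ + π.μ + 1))
    (s := fun _ => (π.μ + 1) * ((π.ℓ + 1) * termSize π + (π.ℓ + 1)) + (π.μ + 1)) (d := termDeg π) h2
  simp only [Finset.sum_const, Finset.card_range, smul_eq_mul, hdeg] at h
  exact h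

/-- Size bound of the witness. [folklore] -/
def gKSize : ℕ := termSumSize π + 6 * π.ℓ + 6 * π.μ + 2

/-- Formal degree bound of the witness. [folklore] -/
def gKDeg : ℕ := termDeg π + 2 * π.ℓ + 2 * π.μ + 2

/-- **The witness `gK` has a constant-free circuit of size `gKSize` and formal degree `gKDeg`.** [cite: Burgisser2006, Def. 2.7] -/
theorem hasTauDeg_gK : HasTauDeg (gK π) (gKSize π) (gKDeg π) := by
  unfold gK gKSize gKDeg
  have hY : HasTauDeg (YSEL π) (6 * π.ℓ) (2 * π.ℓ + 1) :=
    hasTauDeg_selProd (fun t => HasTauDeg.X _) (fun t => HasTauDeg.X _)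
  have hZ : HasTauDeg (ZSEL π) (6 * π.μ) (2 * π.μ + 1) :=
    hasTauDeg_selProd (fun t => HasTauDeg.X _) (fun t => HasTauDeg.X _)
  exact ((((hasTauDeg_TERMSUM π).rename (ιD π)).mul hY).mul hZ).mono (by omega) (by omega)

/-- `termSize` is polynomial in `ℓ + μ + M`. [folklore] -/
theorem termSize_le : termSize π ≤ 60 * (π.ℓ + π.μ + π.M + 1) ^ 2 := by
  unfold termSize; nlinarith [Nat.zero_le π.ℓ, Nat.zero_le π.μ, Nat.zero_le π.M]

/-- `gKSize ≤ 80 (ℓ + μ + M + 1)^5`. [folklore] -/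
theorem gKSize_le : gKSize π ≤ 80 * (π.ℓ + π.μ + π.M + 1) ^ 5 := by
  have h := termSize_le π
  unfold gKSize termSumSize
  set s := π.ℓ + π.μ + π.M + 1 with hs
  have hl : π.ℓ + 1 ≤ s := by omega
  have hm : π.μ + 1 ≤ s := by omega
  have hlm : π.ℓ + π.μ + 1 ≤ s := by omega
  have h1 : (π.ℓ + 1) * termSize π + (π.ℓ + 1) ≤ s * (60 * s ^ 2) + s :=
    Nat.add_le_add (Nat.mul_le_mul hl h) hl
  have h2 : (π.μ + 1) * ((π.ℓ + 1) * termSize π + (π.ℓ + 1)) + (π.μ + 1) ≤ s * (s * (60 * s ^ 2) + s) + s :=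
    Nat.add_le_add (Nat.mul_le_mul hm h1) hm
  have h3 : (π.ℓ + π.μ + 1) * ((π.μ + 1) * ((π.ℓ + 1) * termSize π + (π.ℓ + 1)) + (π.μ + 1)) + (π.ℓ + π.μ + 1) ≤
      s * (s * (s * (60 * s ^ 2) + s) + s) + s :=
    Nat.add_le_add (Nat.mul_le_mul hlm h2) hlm
  have hs1 : 1 ≤ s := by omega
  have e5 : s * (s * (s * (60 * s ^ 2) + s) + s) + s = 60 * s ^ 5 + s ^ 3 + s ^ 2 + s := by ring
  have p3 : s ^ 3 ≤ s ^ 5 := Nat.pow_le_pow_right hs1 (by norm_num)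
  have p2 : s ^ 2 ≤ s ^ 5 := Nat.pow_le_pow_right hs1 (by norm_num)
  have p1 : s ≤ s ^ 5 := by
    calc s = s ^ 1 := (pow_one s).symm
      _ ≤ s ^ 5 := Nat.pow_le_pow_right hs1 (by norm_num)
  have hlin : 6 * π.ℓ + 6 * π.μ + 2 ≤ 14 * s := by omega
  rw [e5] at h3
  omega

/-- `gKDeg ≤ 6 (ℓ + μ + M) + 14`. [folklore] -/
theorem gKDeg_le : gKDeg π ≤ 6 * (π.ℓ + π.μ + π.M) + 14 := by
  unfold gKDeg termDeg; omega

/-! ### The family -/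

/-- The circuit data of the `P/poly` language deciding the bit array: a size polynomial and a
`B₂`-circuit family. [cite: Burgisser2006, proof of Thm. 4.1(2)] -/
structure KData where
  /-- size polynomial -/
  sB : Polynomial ℕ
  /-- the circuits -/
  CF : CircuitFamily
  /-- basis `B₂` -/
  har : ∀ m, (CF m).IsOver B2
  /-- size bound -/
  hsize : ∀ m, (CF m).size ≤ sB.eval m

namespace KData

variable (K : KData)

/-- The transcript block size for `(ℓ, μ)`: the circuit size bound at the largest query length. [cite: Burgisser2006, proof of Thm. 4.1(2)] -/
def M (ℓ μ : ℕ) : ℕ := K.sB.eval (8 * (ℓ + μ) + 9)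

/-- The parameters of the member `(ℓ, μ)` (reducible, so that `(K.params ℓ μ).ℓ` unfolds to `ℓ`). [cite: Burgisser2006, proof of Thm. 4.1(2)] -/
abbrev params (ℓ μ : ℕ) : KParams where
  ℓ := ℓ
  μ := μ
  M := K.M ℓ μ
  CF := K.CF
  har := K.har
  hM := fun m hm => (K.hsize m).trans (TM2Iter.eval_mono K.sB hm)

/-- **The family `G_{ℓ,μ}`**: the Boolean sum of the witness of the member `(ℓ, μ)`. [cite: Burgisser2006, Thm. 2.11] -/
def G (ℓ μ : ℕ) : MvPolynomial (KoiranVars ℓ μ) ℤ :=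
  DefVNP.bsum (gK (K.params ℓ μ))

/-- The number of Boolean variables of the member indexed by `r` (`(ℓ, μ) = Nat.unpair r`). [folklore] -/
def u (r : ℕ) : ℕ := (Nat.unpair r).1 + ((Nat.unpair r).2 + K.M (Nat.unpair r).1 (Nat.unpair r).2)

/-- The enumeration of the Boolean block. [folklore] -/
def ε (ℓ μ : ℕ) : BV (K.params ℓ μ) ≃ Fin (ℓ + (μ + K.M ℓ μ)) :=
  (Equiv.sumCongr (Equiv.refl _) finSumFinEquiv).trans finSumFinEquiv

/-- The `VP⁰` witness family, Boolean block enumerated by `Fin (u r)`. [cite: Burgisser2006, Def. 2.8] -/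
def g (r : ℕ) : MvPolynomial (KoiranVars (Nat.unpair r).1 (Nat.unpair r).2 ⊕ Fin (K.u r)) ℤ :=
  rename (Sum.map id (K.ε (Nat.unpair r).1 (Nat.unpair r).2)) (gK (K.params (Nat.unpair r).1 (Nat.unpair r).2))

/-- The block size is polynomial in `r`. [folklore] -/
theorem M_le (r : ℕ) : K.M (Nat.unpair r).1 (Nat.unpair r).2 ≤ (K.sB.comp (16 * Polynomial.X + 9)).eval r := by
  unfold M
  rw [Polynomial.eval_comp]
  refine TM2Iter.eval_mono K.sB ?_
  have h1 := Nat.unpair_left_le r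
  have h2 := Nat.unpair_right_le r
  simp only [Polynomial.eval_add, Polynomial.eval_mul, Polynomial.eval_ofNat, Polynomial.eval_X]
  omega

/-- The number of variables of a member is linear in `ℓ + μ + M`. [folklore] -/
theorem card_vars_le (ℓ μ M : ℕ) : Fintype.card (KoiranVars ℓ μ ⊕ Fin (ℓ + (μ + M))) ≤ 4 * (ℓ + μ + M + 1) := by
  simp only [KoiranVars, Fintype.card_sum, Fintype.card_fin]
  omega

/-- **The witness family is in `VP⁰`.** [cite: Burgisser2006, Def. 2.7] -/
theorem isVP0Family_g : IsVP0Family (σ := fun r => KoiranVars (Nat.unpair r).1 (Nat.unpair r).2 ⊕ Fin (K.u r)) K.g := by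
  have hMp : IsPBounded fun r => K.M (Nat.unpair r).1 (Nat.unpair r).2 :=
    (isPBounded_iff_exists_polynomial_holds _).2 ⟨_, K.M_le⟩
  have hl : IsPBounded fun r => (Nat.unpair r).1 := IsPBounded.id.mono fun r => Nat.unpair_left_le r
  have hm : IsPBounded fun r => (Nat.unpair r).2 := IsPBounded.id.mono fun r => Nat.unpair_right_le r
  have hS : IsPBounded fun r => (Nat.unpair r).1 + (Nat.unpair r).2 + K.M (Nat.unpair r).1 (Nat.unpair r).2 + 1 :=
    IsPBounded.add_holds (IsPBounded.add_holds (IsPBounded.add_holds hl hm) hMp) (IsPBounded.const 1)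
  refine IsVP0Family.of_hasTauDeg ?_ (s := fun r => 80 * ((Nat.unpair r).1 + (Nat.unpair r).2 + K.M (Nat.unpair r).1 (Nat.unpair r).2 + 1) ^ 5)
    (d := fun r => 6 * ((Nat.unpair r).1 + (Nat.unpair r).2 + K.M (Nat.unpair r).1 (Nat.unpair r).2) + 14) ?_ ?_ fun r => ?_
  · exact (IsPBounded.mul_holds (IsPBounded.const 4) hS).mono fun r =>
      card_vars_le (Nat.unpair r).1 (Nat.unpair r).2 (K.M (Nat.unpair r).1 (Nat.unpair r).2)
  · exact IsPBounded.mul_holds (IsPBounded.const 80) (IsPBounded.pow_holds hS 5)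
  · exact IsPBounded.add_holds (IsPBounded.mul_holds (IsPBounded.const 6)
      (IsPBounded.add_holds (IsPBounded.add_holds hl hm) hMp)) (IsPBounded.const 14)
  · exact ((hasTauDeg_gK (K.params (Nat.unpair r).1 (Nat.unpair r).2)).rename _).mono
      (gKSize_le (K.params _ _)) (gKDeg_le (K.params _ _))

/-- **The family `(G_{ℓ,μ})` is in `VNP⁰`** (indexed by `r ↦ Nat.unpair r`). [cite: Burgisser2006, Def. 2.8 with Thm. 2.11] -/
theorem isVNP0Family_G : IsVNP0Family (σ := fun r => KoiranVars (Nat.unpair r).1 (Nat.unpair r).2)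
    fun r => K.G (Nat.unpair r).1 (Nat.unpair r).2 :=
  ⟨K.u, K.g, K.isVP0Family_g, fun _ => (DefVNP.boolSum_rename_equiv (k := ℤ) _ _).symm⟩

/-- `blockSubst` is the digit substitution of the member `(bitLen (p n), bitLen (q n))`. [cite: Burgisser2006, proof of Thm. 4.1(2)] -/
theorem blockSubst_eq_bsubN (p q : ℕ → ℕ) (n : ℕ) :
    blockSubst p q n = bsubN (K.params (bitLen (p n)) (bitLen (q n))) n (p n) (q n) := by
  funext v
  rcases v with yz | i | i | i
  · rfl
  · change C (((n.testBit i).toNat : ℤ)) = C (toK ℤ (n.testBit i))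
    cases n.testBit i <;> rfl
  · change C ((((p n).testBit i).toNat : ℤ)) = C (toK ℤ ((p n).testBit i))
    cases (p n).testBit i <;> rfl
  · change C ((((q n).testBit i).toNat : ℤ)) = C (toK ℤ ((q n).testBit i))
    cases (q n).testBit i <;> rfl

/-- **The substitution identity**: if the circuits decide `b` on the index domain then
`B_n = G_{ℓ(n), λ(n)}(Y, Z, bits of n, p n, q n)`. [cite: Burgisser2006, proof of Thm. 4.1(2)] -/
theorem aeval_blockSubst_G (p q : ℕ → ℕ) (hpn : ∀ n, n ≤ p n) (b : ℕ → ℕ → ℕ → Bool) (B : Language Bool)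
    (hb : ∀ n k j, k ≤ q n → j ≤ p n → (encBitQuery n k j true ∈ B ↔ b n k j = true))
    (hdec : K.CF.Decides B) (n : ℕ) :
    aeval (blockSubst p q n) (K.G (bitLen (p n)) (bitLen (q n))) = twoBlockPoly p q b n := by
  have hP : p n < 2 ^ (K.params (bitLen (p n)) (bitLen (q n))).ℓ := lt_two_pow_bitLen (p n)
  have hQ : q n < 2 ^ (K.params (bitLen (p n)) (bitLen (q n))).μ := lt_two_pow_bitLen (q n)
  have hn : n < 2 ^ ((K.params (bitLen (p n)) (bitLen (q n))).ℓ + (K.params (bitLen (p n)) (bitLen (q n))).μ) :=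
    (lt_of_le_of_lt (hpn n) hP).trans_le (Nat.pow_le_pow_right (by norm_num) (Nat.le_add_right _ _))
  rw [G, blockSubst_eq_bsubN K p q n,
    aeval_bsubN_bsum_gK (K.params (bitLen (p n)) (bitLen (q n))) (p n) (q n) hn hP hQ (fun x => B.boolIndicator x) hdec,
    twoBlockPoly]
  -- restrict the ranges
  rw [DefVNP.sum_range_of_eq_zero (Nat.succ_le_of_lt hP)]
  · refine Finset.sum_congr rfl fun j hj => ?_
    have hj' : j ≤ p n := Nat.lt_succ_iff.1 (Finset.mem_range.1 hj)
    rw [DefVNP.sum_range_of_eq_zero (Nat.succ_le_of_lt hQ)]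
    · refine Finset.sum_congr rfl fun k hk => ?_
      have hk' : k ≤ q n := Nat.lt_succ_iff.1 (Finset.mem_range.1 hk)
      rw [decide_eq_true hj', decide_eq_true hk', toK_true, one_mul, one_mul]
      by_cases hbk : b n k j = true
      · rw [hbk, if_pos rfl, (Set.mem_iff_boolIndicator _ _).1 ((hb n k j hk' hj').2 hbk), toK_true, C_1, one_mul]
      · rw [if_neg hbk, (Set.notMem_iff_boolIndicator _ _).1 (fun h => hbk ((hb n k j hk' hj').1 h)), toK_false,
          C_0, zero_mul]
    · intro k hk
      rw [decide_eq_false (by omega : ¬ k ≤ q n)]; simp [toK]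
  · intro j hj
    refine Finset.sum_eq_zero fun k _ => ?_
    rw [decide_eq_false (by omega : ¬ j ≤ p n)]; simp [toK]

/-- The glue announced in the header of `KoiranCriterionWitness.lean` under the name
`aeval_blockSubst_bsum_gK`: the Boolean sum of the witness of the member `(bitLen (p n), bitLen (q n))`
becomes `twoBlockPoly p q b n` under `blockSubst p q n` (this is `aeval_blockSubst_G` with `G`
unfolded). [cite: Burgisser2006, proof of Thm. 4.1(2)] -/
theorem aeval_blockSubst_bsum_gK (p q : ℕ → ℕ) (hpn : ∀ n, n ≤ p n) (b : ℕ → ℕ → ℕ → Bool) (B : Language Bool)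
    (hb : ∀ n k j, k ≤ q n → j ≤ p n → (encBitQuery n k j true ∈ B ↔ b n k j = true))
    (hdec : K.CF.Decides B) (n : ℕ) :
    aeval (blockSubst p q n) (DefVNP.bsum (gK (K.params (bitLen (p n)) (bitLen (q n))))) = twoBlockPoly p q b n :=
  K.aeval_blockSubst_G p q hpn b B hb hdec n

end KData

end KoiranW

/-! ### The discharge -/

/-- **Discharge of `Burgisser2009_thm41_koiranStep`** (Bürgisser 2009, Thm. 2.11 = Koiran 2004,
Thm. 6.1, as applied in the proof of Thm. 4.1(2)): the two-block interpolating polynomials of a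
`P/poly`-decidable 0/1 array are substitution instances of one `VNP⁰` family. [cite: Burgisser2006, proof of Thm. 4.1(2), p. 14–15 (via Thm. 2.11 = Koiran2004 Thm. 6.1)] -/
theorem Burgisser2009_thm41_koiranStep_holds : Burgisser2009_thm41_koiranStep := by
  intro p q _ _ hpn b hB
  obtain ⟨B, hBP, hb⟩ := hB
  simp only [PPoly, Set.mem_iUnion] at hBP
  obtain ⟨sB, C, hC, hdec⟩ := hBP
  let K : KoiranW.KData := ⟨sB, C, fun m => (hC m).1, fun m => (hC m).2⟩
  exact ⟨K.G, K.isVNP0Family_G, fun n => (K.aeval_blockSubst_G p q hpn b B hb hdec n).symm⟩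

end Literature.Computability.AlgebraicComplexity
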